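import Summits.QuantumFields.YangMills.Theorems.BalabanUVNodesN07ConstraintLogBridge
import HarnessLib

/-!
# N07 — THE `T47`-CHART IMAGE, RETRACTED TO `SU(N)`, AVERAGES TO `V` (CURE-SPEC step 5 for LOCATED-g28-2, frame-free letters): any `SU(N)`-valued configuration `U` whose matrices are
# print's chart field `exp(iη·T47(𝒜(V) + 𝔄(V)))·U₀` satisfies `Ū^k U = V` once it passes the averaging guard — from ✓`iterMh_T47_eq_of_logDisc` (✓p828600 §5)

Cell `pub-ymgap`, width seat `pub-ymgap-dag-n07-w3` (g28), INTENT-10 ∕ CLAIM-10.  `--kind proof --supports stmt-QuantumFields-27238 --as helper`; count-neutral.  [15] = [Balaban1985Variational].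

WHAT (kernel, sorry-free, standard axioms; any `N`, any background `U₀`).
* ★ `iter_eq_of_iterMh_eq` — bookkeeping converse of ✓`…N07KnitTokensForceCZero.iterMh_chart_eq_of_rng`: `coeField U = X`, guard `SmallBelow (avOfRecord) k U`, `Ū^k_h X = ↑V` ⟹ `Ū^k U = V`
  (`↑Ū = Ū_h` under the guard, ✓`iterMh_coeField_of_smallBelow`; `coeField` injective).
* ★★★ `iter_T47Chart_eq` — **THE CURED CHART's AVERAGE CONJUNCT at the scheme of record's fixed point**: for any `U : GaugeField (F.P K) 0 (SU N)` with
  `coeField U = expOver U₀ (η•evLit (T47 H♭ C^{sl} ε_C (𝒜(V) + 𝔄(V))))` (print's (15)+(47) configuration, however retracted to `SU(N)`) and the guard below `k`, under the hypotheses of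
  ✓`iterMh_T47_eq_of_logDisc` (EL regime + Sect. C regime with `ε₄ + a𝔄 ≤ a_C`, `FrakGSliceTok`, `T47 A′` traceless — g27 ✓`trace_equiv_T47OfRecord_eq_zero_two` at `N = 2` —, the two log-disc rows):
  `Averaging.iter (avOfRecord F N K) k U = V` — the (rng) AVERAGE conjunct that def-Y's (47)-free `S.chartCfg V` cannot carry (✓`COfRecord_eq_zero_of_knitTokens`) IS a theorem for the `T47`-chart.

HONEST LABELS.  Bookkeeping over ✓p828600; every analytic input displayed (regimes, slice letter, tracelessness, log-disc rows, guard); the chart itself is NOT re-typed here (def-Y custody, (A4)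
deferred) — the statement is about ANY `SU(N)` field with those matrices; nothing of Bałaban's estimates; count-neutral; K0ᴬ ⟨27238⟩ NOT closed; N07 NOT discharged; R4 is the conditional
finite-𝕋⁴ rung `BalabanLadder.UV` only; finite torus, fixed `ε` — nothing continuum ∕ OS ∕ Clay.  **The Yang–Mills mass gap is NOT proved by any of this.**  No `sorry`, no `def`, no
`instance ∕ notation`; standard axioms.
-/

set_option autoImplicit false

noncomputable section

open scoped Matrix Matrix.Norms.L2Operator InnerProductSpace

namespace Summit.QuantumFields.YangMills.Theorems.N07T47ChartAverage

open Literature.MathematicalPhysics.QuantumFieldTheory.Balaban1983to89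
open Literature.MathematicalPhysics.QuantumFieldTheory.Balaban1983to89.T4Continuum (T4Family)
open Literature.MathematicalPhysics.QuantumFieldTheory.Balaban1983to89.Node00
open B15AveragingHolomorphic (iterMh)
open B11Eq103H1Complex (SiteL2K BondL2K)
open B11Eq111FrakG (nabla115)
open B11Eq115Space (JetSup)
open B11Eq174Chart (Regime)
open B11Eq90V0GroupComposed (T47)
open Summit.QuantumFields.YangMills.Theorems.N07ConstraintLogBridge (iterMh_T47_eq_of_logDisc)

section Record

variable (F : T4Family) (N : ℕ) [NeZero N] (K : ℕ) (k : ℕ) (Ω : ℕ → Set (Site (F.P K) 0)) (U₀ : GaugeField (F.P K) 0 (SU N))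
  [Fact (0 < (F.L : ℝ))] [Fact (0 < (F.P K).eta k)] [Fact (0 < c0Rec F K k)] [Fact (∀ c, 0 < wBRec F K k c)]
  (levB : PBond (F.P K) k → ℕ)

omit [Fact (0 < (F.L : ℝ))] [Fact (0 < (F.P K).eta k)] [Fact (0 < c0Rec F K k)] [Fact (∀ c, 0 < wBRec F K k c)] in
/-- ★ **From the holomorphic average to the genuine one**: if `U`'s matrices are `X`, `U` passes the guard below `k`, and `Ū^k_h X = ↑V`, then `Ū^k U = V`.
[cite: Balaban1987RG1, (0.4) p.253, (0.21) p.256 (bookkeeping)] -/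
theorem iter_eq_of_iterMh_eq {U : GaugeField (F.P K) 0 (SU N)} {X : PBond (F.P K) 0 → Matrix (Fin N) (Fin N) ℂ} {V : GaugeField (F.P K) k (SU N)}
    (hUX : coeField U = X) (hguard : SmallBelow (avOfRecord F N K) k U) (h : iterMh k X = coeField V) :
    Averaging.iter (avOfRecord F N K) k U = V := by
  have e : coeField (Averaging.iter (avOfRecord F N K) k U) = coeField V := by
    rw [← iterMh_coeField_of_smallBelow F N k U hguard, hUX, h]
  funext c
  exact Subtype.ext (by simpa only [coeField_apply] using congrFun e c)

variable (a : ℝ)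
  (hposb : ∀ x, x ≠ 0 → 0 < RCLike.re ⟪x, laplaceAOfRecord F N k U₀ (QOfRecord F N k U₀) (QflatOfRecord F N k) a x⟫_ℂ)
  (hQ : Function.Surjective (QOfRecord F N k U₀))
  (Gp : SiteL2K ℂ (F.P K).d (fun _ => (F.P K).sitesPerDir 0) (c0Rec F K k) (WRec N) →ₗ[ℂ]
    SiteL2K ℂ (F.P K).d (fun _ => (F.P K).sitesPerDir 0) (c0Rec F K k) (WRec N))
  (Δ2 : BondL2K ℂ (F.P K).d (fun _ => (F.P K).sitesPerDir 0) (c0Rec F K k) (WRec N) →ₗ[ℂ]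
    BondL2K ℂ (F.P K).d (fun _ => (F.P K).sitesPerDir 0) (c0Rec F K k) (WRec N))
  (hposπ : ∀ x, x ≠ 0 → 0 < RCLike.re ⟪x, laplaceAOfRecordAt F N k U₀ (hessOpOfRecord128 F N k U₀ Gp (QflatOfRecord F N k) Δ2)
    (QOfRecord F N k U₀) (QflatOfRecord F N k) a x⟫_ℂ)

/-- ★★★ **THE `T47`-CHART FIELD AT THE SCHEME's FIXED POINT AVERAGES TO `V`**: any `SU(N)`-valued `U` with matrices `expOver U₀ (η•evLit (T47 H♭ C^{sl} ε_C (𝒜(V) + 𝔄(V))))` — print's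
configuration `exp(iη(A′ − HD(A′)))·U₀` ((15), (47)) — that passes the guard below `k` has `Ū^k U = V`, under the hypotheses of ✓`iterMh_T47_eq_of_logDisc`.  This is the (rng) AVERAGE conjunct for
the `T47`-chart at `A := 𝒜(V)`; compare ✓`COfRecord_eq_zero_of_knitTokens` for def-Y's (47)-free chart.
[cite: Balaban1985Variational, (15) p.280, (20) p.281, (44)–(48) p.285, Prop. 6 (116) p.295; Balaban1987RG1, (0.21) p.256] -/
theorem iter_T47Chart_eq (dom : Set (GaugeField (F.P K) k (SU N))) {εC B₀ C₄ a₃ j a𝔄 ε₄ b C₂ c₄ aC : ℝ}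
    (R : Regime (frakGOfRecordAtBg128 F N K k Ω U₀ Gp Δ2 a hposπ hQ) (0 : Space115Lit F N K k Ω U₀ →L[ℂ] Space115Lit F N K k Ω U₀)
      (WOfRecordAt F N K k Ω U₀ levB a hposb hQ εC Gp) B₀ 0 C₄ a₃ j a𝔄 ε₄)
    (hJ : ‖JOfRecordAtBg F N K k Ω U₀‖ ≤ j) {V : GaugeField (F.P K) k (SU N)} (h𝔄 : ‖frakAOfRecordAtBg128 F N K k Ω U₀ levB Gp Δ2 a hposπ hQ V‖ < a𝔄)
    (h𝔊 : FrakGSliceTok F N K k Ω U₀ Gp Δ2 a hposπ hQ)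
    (RC : Regime (H1OfRecordAtBgFlat F N K k Ω U₀ levB a hposb hQ) (0 : Space115Lit F N K k Ω U₀ →L[ℂ] Space115Lit F N K k Ω U₀)
      (CslOfRecord F N K k Ω U₀ levB) b 0 C₂ c₄ 0 aC εC)
    (haC : ε₄ + a𝔄 ≤ aC)
    (htr : ∀ b', (JetSup.equiv _ _ (nabla115 ((F.P K).eta k) (unitsOfRecord F N U₀))
        (T47 (H1OfRecordAtBgFlat F N K k Ω U₀ levB a hposb hQ) (CslOfRecord F N K k Ω U₀ levB) εC
          ((bgSchemeOfRecord F N K k Ω U₀ dom levB Gp Δ2 a hposπ hposb hQ εC B₀ C₄ a₃ j a𝔄 ε₄).sol V + frakAOfRecordAtBg128 F N K k Ω U₀ levB Gp Δ2 a hposπ hQ V)) b').trace = 0)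
    {U : GaugeField (F.P K) 0 (SU N)}
    (hU : coeField U = expOver U₀ ((((F.P K).eta k : ℝ) : ℂ) • evLit F N K k Ω U₀
        (T47 (H1OfRecordAtBgFlat F N K k Ω U₀ levB a hposb hQ) (CslOfRecord F N K k Ω U₀ levB) εC
          ((bgSchemeOfRecord F N K k Ω U₀ dom levB Gp Δ2 a hposπ hposb hQ εC B₀ C₄ a₃ j a𝔄 ε₄).sol V + frakAOfRecordAtBg128 F N K k Ω U₀ levB Gp Δ2 a hposπ hQ V))))
    (hguard : SmallBelow (avOfRecord F N K) k U)
    (hdiscA : ∀ c, ‖iterMh k (coeField U) c * star (Averaging.iter (avOfRecord F N K) k U₀ c : Matrix (Fin N) (Fin N) ℂ) - 1‖ < 1)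
    (hdiscV : ∀ c, ‖(V c : Matrix (Fin N) (Fin N) ℂ) * star (Averaging.iter (avOfRecord F N K) k U₀ c : Matrix (Fin N) (Fin N) ℂ) - 1‖ < 1) :
    Averaging.iter (avOfRecord F N K) k U = V := by
  have hdiscA' := fun c => by simpa only [hU] using hdiscA c
  exact iter_eq_of_iterMh_eq F N K k hU hguard
    (iterMh_T47_eq_of_logDisc F N K k Ω U₀ levB a hposb hQ Gp Δ2 hposπ dom R hJ h𝔄 h𝔊 RC haC htr hdiscA' hdiscV)

end Record

end Summit.QuantumFields.YangMills.Theorems.N07T47ChartAverage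

end
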